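import Summits.CriticalPhenomena.PercolationContinuityZ3.Theorems.Transplant.FKThreeApexOmega
import Summits.CriticalPhenomena.PercolationContinuityZ3.Theorems.Transplant.FKThreeApexOmegaBigSum
import Summits.CriticalPhenomena.PercolationContinuityZ3.Theorems.Transplant.FKThreeApexOmegaPieces
import HarnessLib

/-!
# The three-apex monoid: the semigroup theorem for `Ω_q` — layer 2: hat vectors, block scalings, the special points and their products

Helper file (`--supports stmt-CriticalPhenomena-4575`), FK sub-lane `prim-bschramm-fk-3` (gen 14); builds on p205010 (kernel theorem, internal audit
signed; external expert review pending).  Pure real algebra, no sorries; standard axioms.  Memo `bschramm/prim-bschramm-fk-3/DISJOINT-VIA-U.md` §2, §7 (B1–B5).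

The closure of `Ω_q` under products is proved in hat coordinates, where the product is coordinatewise.  This file provides: the hat vector type `H5`
with `H5.mul`, the transfer `H5.ofV` (`ofV (conv z Z) = ofV z * ofV Z`), the forms `nab, nac, ja, phi` (= `N^{(ab)}, N^{(ac)}, J_a, Φ_a` of layer 1) and the
predicate `H5.Om` (`InOmega q Z ↔ Om q (ofV Z)`); the two BLOCK SCALINGS `(u,x,y) ↦ λ·`, `(z,v) ↦ μ·` (all forms are bi-homogeneous, `Om` is invariant);
the SPECIAL POINTS of the memo — curved-boundary points `bdPt q s t = (D, X, Y, s, 1)`, ab-edge-ray points `(1, 1+e, 1, 1, 1+e)`, diagonal points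
`(1, 1+b, 1+b, 1, 1+b)`, face points — and, from the certified polynomials of `…OmegaBig*` and `…OmegaPieces`, that the relevant PRODUCTS of special points lie
in `Ω_q`: **`Om.bd_mul_bd`** (uses `Big.boundary_prod_det` + `Big.bigPoly_nonneg`), `Om.bd_mul_edge`, `Om.bd_mul_diag`, `Om.face_mul_face`.  The fibre/endpoint
reduction and the final assembly (`Om.mul`, hence `InK.uCond`) are layer 3.
[folklore]
-/

noncomputable section

namespace Summit.CriticalPhenomena.PercolationContinuityZ3.Theorems

namespace FK

namespace ThreeApex

/-- A vector in hat (character) coordinates `(û, x̂, ŷ, ẑ, v̂)`. [folklore] -/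
@[ext] structure H5 where
  /-- `û = Z_0` -/
  u : ℝ
  /-- `x̂ = Z_0 + Z_ab` -/
  x : ℝ
  /-- `ŷ = Z_0 + Z_ac` -/
  y : ℝ
  /-- `ẑ = Z_0 + Z_bc` -/
  z : ℝ
  /-- `v̂ = ΣZ` -/
  v : ℝ

namespace H5

/-- Coordinatewise product (the product of the monoid in hat coordinates). [folklore] -/
def mul (a b : H5) : H5 := ⟨a.u * b.u, a.x * b.x, a.y * b.y, a.z * b.z, a.v * b.v⟩

/-- The hat vector of a fibre-mass vector. [folklore] -/
def ofV (Z : V5) : H5 := ⟨Z.z0, hx Z, hy Z, hz Z, Z.total⟩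

/-- `conv` becomes the coordinatewise product. [folklore] -/
theorem ofV_conv (z Z : V5) : ofV (conv z Z) = mul (ofV z) (ofV Z) := by
  obtain ⟨h0, h1, h2, h3, h4⟩ := hat_conv z Z
  simp only [ofV, mul, h1, h2, h3, h4, h0]

/-- `mul` is commutative. [folklore] -/
theorem mul_comm (a b : H5) : mul a b = mul b a := by
  ext <;> simp only [mul] <;> ring

/-- `mul` is associative. [folklore] -/
theorem mul_assoc (a b c : H5) : mul (mul a b) c = mul a (mul b c) := by
  ext <;> simp only [mul] <;> ring

/-- `N^{(ab)}` in hat coordinates. [folklore] -/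
def nab (q : ℝ) (h : H5) : ℝ := h.x * h.v + (1 - q) * h.y * h.z - (2 - q) * h.u * h.v
/-- `N^{(ac)}` in hat coordinates. [folklore] -/
def nac (q : ℝ) (h : H5) : ℝ := h.y * h.v + (1 - q) * h.x * h.z - (2 - q) * h.u * h.v
/-- `J_a` in hat coordinates. [folklore] -/
def ja (h : H5) : ℝ := h.z * (h.x + h.y - h.u) - h.u * h.v
/-- `Φ_a(w₁,w₂)` in hat coordinates. [folklore] -/
def phi (q w₁ w₂ : ℝ) (h : H5) : ℝ := w₁ ^ 2 * nab q h + w₂ ^ 2 * nac q h + w₁ * w₂ * ((2 - q) * ja h)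

/-- `nab (ofV Z) = N^{(ab)}(Z)`. [folklore] -/
theorem nab_ofV (q : ℝ) (Z : V5) : nab q (ofV Z) = masterN q (swapBC Z) := by
  simp only [nab, ofV, masterN, swapBC, hx, hy, hz, V5.total]; ring
/-- `nac (ofV Z) = N^{(ac)}(Z)`. [folklore] -/
theorem nac_ofV (q : ℝ) (Z : V5) : nac q (ofV Z) = masterN q Z := by
  simp only [nac, ofV, masterN, hx, hy, hz, V5.total]; ring
/-- `ja (ofV Z) = J_a(Z)`. [folklore] -/
theorem ja_ofV (Z : V5) : ja (ofV Z) = jA Z := by simp only [ja, ofV, jA]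
/-- `phi (ofV Z) = Φ_a(Z)` (`uForm`). [folklore] -/
theorem phi_ofV (q w₁ w₂ : ℝ) (Z : V5) : phi q w₁ w₂ (ofV Z) = uForm q w₁ w₂ Z := by
  rw [uForm_eq, phi, nab_ofV, nac_ofV, ja_ofV]

/-- `Ω_q` in hat coordinates. [folklore] -/
structure Om (q : ℝ) (h : H5) : Prop where
  /-- `û > 0` -/
  u_pos : 0 < h.u
  /-- `ẑ > 0` -/
  z_pos : 0 < h.z
  /-- `x̂ ≥ û` -/
  x_ge : h.u ≤ h.x
  /-- `ŷ ≥ û` -/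
  y_ge : h.u ≤ h.y
  /-- `x̂ẑ ≤ ûv̂` -/
  sxz : h.x * h.z ≤ h.u * h.v
  /-- `ŷẑ ≤ ûv̂` -/
  syz : h.y * h.z ≤ h.u * h.v
  /-- `N^{(ab)} ≥ 0` -/
  nab : 0 ≤ nab q h
  /-- `N^{(ac)} ≥ 0` -/
  nac : 0 ≤ nac q h
  /-- `(U_a)` -/
  U : ∀ w₁ w₂ : ℝ, 0 ≤ w₁ → 0 ≤ w₂ → 0 ≤ phi q w₁ w₂ h

/-- Transfer: `InOmega q Z ↔ Om q (ofV Z)`. [folklore] -/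
theorem om_ofV_iff (q : ℝ) (Z : V5) : InOmega q Z ↔ Om q (ofV Z) := by
  constructor
  · intro h
    refine ⟨h.u_pos, h.z_pos, h.x_ge, h.y_ge, h.sxz, h.syz, ?_, ?_, fun w₁ w₂ hw₁ hw₂ => ?_⟩
    · rw [nab_ofV]; exact h.nab
    · rw [nac_ofV]; exact h.nac
    · rw [phi_ofV]; exact h.U w₁ w₂ hw₁ hw₂
  · intro h
    refine ⟨h.u_pos, h.z_pos, h.x_ge, h.y_ge, h.sxz, h.syz, ?_, ?_, fun w₁ w₂ hw₁ hw₂ => ?_⟩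
    · rw [← nab_ofV]; exact h.nab
    · rw [← nac_ofV]; exact h.nac
    · rw [← phi_ofV]; exact h.U w₁ w₂ hw₁ hw₂

/-- `v̂ > 0` on `Ω_q`. [folklore] -/
theorem Om.v_pos {q : ℝ} {h : H5} (hh : Om q h) : 0 < h.v := by
  have h2 : 0 < h.x * h.z := mul_pos (lt_of_lt_of_le hh.u_pos hh.x_ge) hh.z_pos
  nlinarith [hh.sxz, hh.u_pos]

/-- The determinant form: `Om` from `N ≥ 0` and `4 N^{(ab)} N^{(ac)} ≥ ((2−q)J_a)²` (copositivity, as in layer 1). [folklore] -/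
theorem Om.of_det {q : ℝ} {h : H5} (hu : 0 < h.u) (hz : 0 < h.z) (hx : h.u ≤ h.x) (hy : h.u ≤ h.y) (hs1 : h.x * h.z ≤ h.u * h.v)
    (hs2 : h.y * h.z ≤ h.u * h.v) (h1 : 0 ≤ H5.nab q h) (h2 : 0 ≤ H5.nac q h) (hdet : ((2 - q) * H5.ja h) ^ 2 ≤ 4 * H5.nab q h * H5.nac q h) :
    Om q h := by
  refine ⟨hu, hz, hx, hy, hs1, hs2, h1, h2, fun w₁ w₂ _ _ => ?_⟩
  simp only [H5.phi]
  set N₁ := H5.nab q h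
  set N₂ := H5.nac q h
  set K := (2 - q) * H5.ja h
  have hP : 0 ≤ w₁ ^ 2 * N₁ + w₂ ^ 2 * N₂ := by positivity
  have hsq : (w₁ * w₂ * K) ^ 2 ≤ (w₁ ^ 2 * N₁ + w₂ ^ 2 * N₂) ^ 2 := by
    have e : (w₁ ^ 2 * N₁ + w₂ ^ 2 * N₂) ^ 2 = (w₁ ^ 2 * N₁ - w₂ ^ 2 * N₂) ^ 2 + w₁ ^ 2 * w₂ ^ 2 * (4 * N₁ * N₂) := by ring
    have e2 : (w₁ * w₂ * K) ^ 2 = w₁ ^ 2 * w₂ ^ 2 * K ^ 2 := by ring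
    rw [e, e2]
    have : w₁ ^ 2 * w₂ ^ 2 * K ^ 2 ≤ w₁ ^ 2 * w₂ ^ 2 * (4 * N₁ * N₂) := mul_le_mul_of_nonneg_left hdet (by positivity)
    nlinarith [sq_nonneg (w₁ ^ 2 * N₁ - w₂ ^ 2 * N₂)]
  have habs : |w₁ * w₂ * K| ≤ w₁ ^ 2 * N₁ + w₂ ^ 2 * N₂ := abs_le_of_sq_le_sq' hsq hP |>.2 |> fun hle =>
    abs_le.2 ⟨by linarith [(abs_le_of_sq_le_sq' hsq hP).1], hle⟩
  linarith [neg_abs_le (w₁ * w₂ * K), habs]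

/-! ### Block scalings -/

/-- Scale the `a`-side block `(û,x̂,ŷ)` by `l` and the `bc`-side block `(ẑ,v̂)` by `m`. [folklore] -/
def scale (l m : ℝ) (h : H5) : H5 := ⟨l * h.u, l * h.x, l * h.y, m * h.z, m * h.v⟩

/-- `N^{(ab)}` is bi-homogeneous. [folklore] -/
theorem nab_scale (q l m : ℝ) (h : H5) : nab q (scale l m h) = l * m * nab q h := by simp only [nab, scale]; ring
/-- `N^{(ac)}` is bi-homogeneous. [folklore] -/
theorem nac_scale (q l m : ℝ) (h : H5) : nac q (scale l m h) = l * m * nac q h := by simp only [nac, scale]; ring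
/-- `J_a` is bi-homogeneous. [folklore] -/
theorem ja_scale (l m : ℝ) (h : H5) : ja (scale l m h) = l * m * ja h := by simp only [ja, scale]; ring
/-- `Φ_a` is bi-homogeneous. [folklore] -/
theorem phi_scale (q w₁ w₂ l m : ℝ) (h : H5) : phi q w₁ w₂ (scale l m h) = l * m * phi q w₁ w₂ h := by
  simp only [phi, nab_scale, nac_scale, ja_scale]; ring

/-- `Ω_q` is invariant under positive block scalings. [folklore] -/
theorem Om.scale {q : ℝ} {h : H5} (hh : Om q h) {l m : ℝ} (hl : 0 < l) (hm : 0 < m) : Om q (scale l m h) := by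
  refine ⟨?_, ?_, ?_, ?_, ?_, ?_, ?_, ?_, fun w₁ w₂ hw₁ hw₂ => ?_⟩
  · simp only [H5.scale]; exact mul_pos hl hh.u_pos
  · simp only [H5.scale]; exact mul_pos hm hh.z_pos
  · simp only [H5.scale]; exact mul_le_mul_of_nonneg_left hh.x_ge hl.le
  · simp only [H5.scale]; exact mul_le_mul_of_nonneg_left hh.y_ge hl.le
  · simp only [H5.scale]; nlinarith [hh.sxz, mul_pos hl hm]
  · simp only [H5.scale]; nlinarith [hh.syz, mul_pos hl hm]
  · rw [nab_scale]; have := hh.nab; positivity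
  · rw [nac_scale]; have := hh.nac; positivity
  · rw [phi_scale]; have := hh.U w₁ w₂ hw₁ hw₂; positivity

/-- Undo a scaling: if a positive block scaling of `h` is in `Ω_q` then so is `h`. [folklore] -/
theorem Om.of_scale {q : ℝ} {h : H5} {l m : ℝ} (hl : 0 < l) (hm : 0 < m) (hh : Om q (H5.scale l m h)) : Om q h := by
  have e : H5.scale l⁻¹ m⁻¹ (H5.scale l m h) = h := by
    ext <;> simp only [H5.scale] <;> field_simp
  rw [← e]; exact hh.scale (inv_pos.2 hl) (inv_pos.2 hm)

/-- Scalings multiply under `mul`. [folklore] -/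
theorem scale_mul (l m l' m' : ℝ) (a b : H5) : mul (scale l m a) (scale l' m' b) = scale (l * l') (m * m') (mul a b) := by
  ext <;> simp only [mul, H5.scale] <;> ring

/-! ### The special points -/

/-- The curved-boundary point `C(s,t)`, written `(D, X, Y, s, 1)` (memo §2). [folklore] -/
def bdPt (q s t : ℝ) : H5 := ⟨Big.bdD q s t, Big.bdX q s t, Big.bdY q s t, s, 1⟩

/-- The ab-edge-ray point with `A`-ratio `1 + e`: `(1, 1+e, 1, 1, 1+e)`. [folklore] -/
def edgePt (e : ℝ) : H5 := ⟨1, 1 + e, 1, 1, 1 + e⟩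

/-- The diagonal point `Δ(1+b)`: `(1, 1+b, 1+b, 1, 1+b)`. [folklore] -/
def diagPt (b : ℝ) : H5 := ⟨1, 1 + b, 1 + b, 1, 1 + b⟩

/-- The `T1`-face point `(1, A, B, 1, A)` with `B = 1+b₁`, `A = B + a₁`. [folklore] -/
def face1Pt (b₁ a₁ : ℝ) : H5 := ⟨1, 1 + b₁ + a₁, 1 + b₁, 1, 1 + b₁ + a₁⟩

/-- The `T2`-face point `(1, A′, B′, 1, B′)` with `A′ = 1+b₂`, `B′ = A′ + a₂`. [folklore] -/
def face2Pt (b₂ a₂ : ℝ) : H5 := ⟨1, 1 + b₂, 1 + b₂ + a₂, 1, 1 + b₂ + a₂⟩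

/-! ### Products of special points lie in `Ω_q` -/

/-- `D(s,t) > 0` for `s ∈ (0,1]`, `t ≥ 0`, `q ≤ 1`. [folklore] -/
theorem bdD_pos {q s t : ℝ} (hq1 : q ≤ 1) (hs0 : 0 < s) (ht : 0 ≤ t) : 0 < Big.bdD q s t := by
  unfold Big.bdD
  have hq' : 0 ≤ 1 - q := sub_nonneg.2 hq1
  have hp : 0 < 2 - q := by linarith
  have h1 : 0 < s * (2 - q) := mul_pos hs0 hp
  have h2 : 0 ≤ s * ((2 - q) * t ^ 2 + 2 * (1 - q) * t) := by positivity
  nlinarith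

/-- The determinant of the product of two curved-boundary points is `(1−s)(1−s₂)·BIG ≥ 0`. [folklore] -/
theorem det_bd_mul_bd {q s s₂ t t₂ : ℝ} (hq0 : 0 ≤ q) (hq1 : q ≤ 1) (hs0 : 0 ≤ s) (hs1 : s ≤ 1) (hr0 : 0 ≤ s₂) (hr1 : s₂ ≤ 1)
    (ht : 0 ≤ t) (ht₂ : 0 ≤ t₂) :
    ((2 - q) * ja (mul (bdPt q s t) (bdPt q s₂ t₂))) ^ 2 ≤
      4 * nab q (mul (bdPt q s t) (bdPt q s₂ t₂)) * nac q (mul (bdPt q s t) (bdPt q s₂ t₂)) := by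
  have key := Big.boundary_prod_det q s s₂ t t₂
  have hB := Big.bigPoly_nonneg hq0 hq1 hs0 hs1 hr0 hr1 ht ht₂
  have e : 4 * nab q (mul (bdPt q s t) (bdPt q s₂ t₂)) * nac q (mul (bdPt q s t) (bdPt q s₂ t₂))
      - ((2 - q) * ja (mul (bdPt q s t) (bdPt q s₂ t₂))) ^ 2 = (1 - s) * (1 - s₂) * Big.bigPoly q s s₂ t t₂ := by
    rw [← key]; simp only [nab, nac, ja, mul, bdPt]; try ring
  have : 0 ≤ (1 - s) * (1 - s₂) * Big.bigPoly q s s₂ t t₂ := by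
    have := sub_nonneg.2 hs1; have := sub_nonneg.2 hr1; positivity
  linarith

/-- The determinant of `C(s,t) · (ab-edge ray)` is `pieceEdge ≥ 0`. [folklore] -/
theorem det_bd_mul_edge {q s t e : ℝ} (hq0 : 0 ≤ q) (hq1 : q ≤ 1) (hs0 : 0 ≤ s) (hs1 : s ≤ 1) (ht : 0 ≤ t) (he : 0 ≤ e) :
    ((2 - q) * ja (mul (bdPt q s t) (edgePt e))) ^ 2 ≤ 4 * nab q (mul (bdPt q s t) (edgePt e)) * nac q (mul (bdPt q s t) (edgePt e)) := by
  have key := Big.pieceEdge_det q s t e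
  have hP := Big.pieceEdge_nonneg hq0 hq1 hs0 hs1 ht he
  have e1 : 4 * nab q (mul (bdPt q s t) (edgePt e)) * nac q (mul (bdPt q s t) (edgePt e)) - ((2 - q) * ja (mul (bdPt q s t) (edgePt e))) ^ 2
      = Big.pieceEdge q s t e := by
    rw [← key]; simp only [nab, nac, ja, mul, bdPt, edgePt]; try ring
  linarith

/-- The determinant of `C(s,t) · Δ(1+b)` is `pieceDiag ≥ 0`. [folklore] -/
theorem det_bd_mul_diag {q s t b : ℝ} (hq0 : 0 ≤ q) (hq1 : q ≤ 1) (hs0 : 0 ≤ s) (hs1 : s ≤ 1) (ht : 0 ≤ t) (hb : 0 ≤ b) :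
    ((2 - q) * ja (mul (bdPt q s t) (diagPt b))) ^ 2 ≤ 4 * nab q (mul (bdPt q s t) (diagPt b)) * nac q (mul (bdPt q s t) (diagPt b)) := by
  have key := Big.pieceDiag_det q s t b
  have hP := Big.pieceDiag_nonneg hq0 hq1 hs0 hs1 ht hb
  have e1 : 4 * nab q (mul (bdPt q s t) (diagPt b)) * nac q (mul (bdPt q s t) (diagPt b)) - ((2 - q) * ja (mul (bdPt q s t) (diagPt b))) ^ 2
      = Big.pieceDiag q s t b := by
    rw [← key]; simp only [nab, nac, ja, mul, bdPt, diagPt]; try ring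
  linarith

/-- The determinant of a `T1`-face point times a `T2`-face point is `pieceFace ≥ 0`. [folklore] -/
theorem det_face_mul_face {q b₁ a₁ b₂ a₂ : ℝ} (hq0 : 0 ≤ q) (hq1 : q ≤ 1) (h1 : 0 ≤ b₁) (h2 : 0 ≤ a₁) (h3 : 0 ≤ b₂) (h4 : 0 ≤ a₂) :
    ((2 - q) * ja (mul (face1Pt b₁ a₁) (face2Pt b₂ a₂))) ^ 2 ≤
      4 * nab q (mul (face1Pt b₁ a₁) (face2Pt b₂ a₂)) * nac q (mul (face1Pt b₁ a₁) (face2Pt b₂ a₂)) := by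
  have key := Big.pieceFace_det q b₁ a₁ b₂ a₂
  have hP := Big.pieceFace_nonneg hq0 hq1 h1 h2 h3 h4
  have e1 : 4 * nab q (mul (face1Pt b₁ a₁) (face2Pt b₂ a₂)) * nac q (mul (face1Pt b₁ a₁) (face2Pt b₂ a₂))
      - ((2 - q) * ja (mul (face1Pt b₁ a₁) (face2Pt b₂ a₂))) ^ 2 = Big.pieceFace q b₁ a₁ b₂ a₂ := by
    rw [← key]; simp only [nab, nac, ja, mul, face1Pt, face2Pt]; try ring
  linarith

/-! ### Boundary coordinates (memo §7 (B1)) -/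

/-- **Boundary coordinates.** If `N^{(ab)} = τ² N^{(ac)}` and `2τ N^{(ac)} + (2−q) J_a = 0` (a point of the curved boundary, `τ = √(N^{(ab)}/N^{(ac)})`),
then `x̂` is determined: `(v̂ − (1−q)ẑ)·(x̂·D̂ − (2−q)û(τ²v̂ + 2τv̂ + ẑ)) = 0` with `D̂ = ẑ((2−q)τ² + 2(1−q)τ + (2−q)) + 2τv̂` (Cramer; the system's determinant is
`(v̂ − (1−q)ẑ)·D̂`). [folklore] -/
theorem bd_coord_x (q τ : ℝ) (h : H5) (h1 : nab q h - τ ^ 2 * nac q h = 0) (h2 : 2 * τ * nac q h + (2 - q) * ja h = 0) :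
    (h.v - (1 - q) * h.z) * (h.x * (h.z * ((2 - q) * τ ^ 2 + 2 * (1 - q) * τ + (2 - q)) + 2 * τ * h.v)
      - (2 - q) * h.u * (τ ^ 2 * h.v + 2 * τ * h.v + h.z)) = 0 := by
  simp only [nab, nac, ja] at h1 h2
  linear_combination (2 * τ * h.v + (2 - q) * h.z) * h1 - ((1 - q) * h.z - τ ^ 2 * h.v) * h2

/-- **Boundary coordinates**, `ŷ`: `(v̂ − (1−q)ẑ)·(ŷ·D̂ − (2−q)û(ẑτ² + 2τv̂ + v̂)) = 0`. [folklore] -/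
theorem bd_coord_y (q τ : ℝ) (h : H5) (h1 : nab q h - τ ^ 2 * nac q h = 0) (h2 : 2 * τ * nac q h + (2 - q) * ja h = 0) :
    (h.v - (1 - q) * h.z) * (h.y * (h.z * ((2 - q) * τ ^ 2 + 2 * (1 - q) * τ + (2 - q)) + 2 * τ * h.v)
      - (2 - q) * h.u * (h.z * τ ^ 2 + 2 * τ * h.v + h.v)) = 0 := by
  simp only [nab, nac, ja] at h1 h2
  linear_combination (h.v - τ ^ 2 * (1 - q) * h.z) * h2 - (2 * τ * (1 - q) * h.z + (2 - q) * h.z) * h1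

/-- A curved-boundary point, normalised by `v̂ = 1`, is the block scaling `scale (û/D̂) 1` of `bdPt q ẑ τ` (given the two boundary equations and
`v̂ > (1−q)ẑ`). [folklore] -/
theorem eq_scale_bdPt {q τ : ℝ} {h : H5} (hv : h.v = 1) (h1 : nab q h - τ ^ 2 * nac q h = 0) (h2 : 2 * τ * nac q h + (2 - q) * ja h = 0)
    (hD : Big.bdD q h.z τ ≠ 0) (hvz : h.v - (1 - q) * h.z ≠ 0) :
    h = scale (h.u / Big.bdD q h.z τ) 1 (bdPt q h.z τ) := by
  have ex := bd_coord_x q τ h h1 h2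
  have ey := bd_coord_y q τ h h1 h2
  rw [hv] at ex ey
  have ex' : h.x * Big.bdD q h.z τ = h.u * Big.bdX q h.z τ := by
    have := mul_eq_zero.1 ex
    rcases this with h0 | h0
    · exact absurd (by simpa [hv] using h0) hvz
    · unfold Big.bdD Big.bdX; linear_combination h0
  have ey' : h.y * Big.bdD q h.z τ = h.u * Big.bdY q h.z τ := by
    have := mul_eq_zero.1 ey
    rcases this with h0 | h0
    · exact absurd (by simpa [hv] using h0) hvz
    · unfold Big.bdD Big.bdY; linear_combination h0
  ext <;> simp only [H5.scale, bdPt]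
  · field_simp
  · field_simp; linear_combination ex'
  · field_simp; linear_combination ey'
  · ring
  · rw [hv]; ring

/-! ### Fibres: moving the `ẑ`-coordinate (memo §7 (B2)) -/

/-- Replace the `ẑ`-coordinate. [folklore] -/
def withZ (h : H5) (ζ : ℝ) : H5 := ⟨h.u, h.x, h.y, ζ, h.v⟩

/-- `Ω_q` with `ẑ ≥ 0` allowed (the formal lower endpoint of a fibre). [folklore] -/
structure OmW (q : ℝ) (h : H5) : Prop where
  /-- `û > 0` -/
  u_pos : 0 < h.u
  /-- `ẑ ≥ 0` -/
  z_nn : 0 ≤ h.z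
  /-- `x̂ ≥ û` -/
  x_ge : h.u ≤ h.x
  /-- `ŷ ≥ û` -/
  y_ge : h.u ≤ h.y
  /-- `x̂ẑ ≤ ûv̂` -/
  sxz : h.x * h.z ≤ h.u * h.v
  /-- `ŷẑ ≤ ûv̂` -/
  syz : h.y * h.z ≤ h.u * h.v
  /-- `N^{(ab)} ≥ 0` -/
  nab : 0 ≤ H5.nab q h
  /-- `N^{(ac)} ≥ 0` -/
  nac : 0 ≤ H5.nac q h
  /-- `(U_a)` -/
  U : ∀ w₁ w₂ : ℝ, 0 ≤ w₁ → 0 ≤ w₂ → 0 ≤ H5.phi q w₁ w₂ h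

/-- `Ω_q ⊆` its weak version. [folklore] -/
theorem Om.toW {q : ℝ} {h : H5} (hh : Om q h) : OmW q h :=
  ⟨hh.u_pos, hh.z_pos.le, hh.x_ge, hh.y_ge, hh.sxz, hh.syz, hh.nab, hh.nac, hh.U⟩

/-- A weak member with `ẑ > 0` is a member. [folklore] -/
theorem OmW.toOm {q : ℝ} {h : H5} (hh : OmW q h) (hz : 0 < h.z) : Om q h :=
  ⟨hh.u_pos, hz, hh.x_ge, hh.y_ge, hh.sxz, hh.syz, hh.nab, hh.nac, hh.U⟩

/-- Along a fibre of a product, every defining quantity is affine in the moving `ẑ`-coordinate. [folklore] -/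
theorem phi_mul_withZ_affine (q w₁ w₂ : ℝ) (a h : H5) (ζ₁ ζ₂ θ : ℝ) :
    phi q w₁ w₂ (mul a (withZ h ((1 - θ) * ζ₁ + θ * ζ₂))) =
      (1 - θ) * phi q w₁ w₂ (mul a (withZ h ζ₁)) + θ * phi q w₁ w₂ (mul a (withZ h ζ₂)) := by
  simp only [phi, nab, nac, ja, mul, withZ]; ring

/-- **Fibre interpolation.** If both endpoints of a segment of a fibre map into `Ω_q` (weakly) under multiplication by `a`, so does every interior
point with positive `ẑ`. [folklore] -/
theorem OmW.interp {q : ℝ} {a h : H5} {ζ₁ ζ₂ θ : ℝ} (hθ0 : 0 ≤ θ) (hθ1 : θ ≤ 1)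
    (H1 : OmW q (mul a (withZ h ζ₁))) (H2 : OmW q (mul a (withZ h ζ₂))) (hz : 0 < a.z * ((1 - θ) * ζ₁ + θ * ζ₂)) :
    Om q (mul a (withZ h ((1 - θ) * ζ₁ + θ * ζ₂))) := by
  have hθ' : 0 ≤ 1 - θ := sub_nonneg.2 hθ1
  refine ⟨?_, ?_, ?_, ?_, ?_, ?_, ?_, ?_, fun w₁ w₂ hw₁ hw₂ => ?_⟩
  · simpa [mul, withZ] using H1.u_pos
  · simpa [mul, withZ] using hz
  · simpa [mul, withZ] using H1.x_ge
  · simpa [mul, withZ] using H1.y_ge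
  · have e1 := H1.sxz; have e2 := H2.sxz
    simp only [mul, withZ] at e1 e2 ⊢
    nlinarith [mul_nonneg hθ' (sub_nonneg.2 e1), mul_nonneg hθ0 (sub_nonneg.2 e2)]
  · have e1 := H1.syz; have e2 := H2.syz
    simp only [mul, withZ] at e1 e2 ⊢
    nlinarith [mul_nonneg hθ' (sub_nonneg.2 e1), mul_nonneg hθ0 (sub_nonneg.2 e2)]
  · have e1 := H1.nab; have e2 := H2.nab
    have e : H5.nab q (mul a (withZ h ((1 - θ) * ζ₁ + θ * ζ₂))) =
        (1 - θ) * H5.nab q (mul a (withZ h ζ₁)) + θ * H5.nab q (mul a (withZ h ζ₂)) := by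
      simp only [H5.nab, mul, withZ]; ring
    rw [e]; positivity
  · have e1 := H1.nac; have e2 := H2.nac
    have e : H5.nac q (mul a (withZ h ((1 - θ) * ζ₁ + θ * ζ₂))) =
        (1 - θ) * H5.nac q (mul a (withZ h ζ₁)) + θ * H5.nac q (mul a (withZ h ζ₂)) := by
      simp only [H5.nac, mul, withZ]; ring
    rw [e]; positivity
  · have e1 := H1.U w₁ w₂ hw₁ hw₂; have e2 := H2.U w₁ w₂ hw₁ hw₂
    rw [phi_mul_withZ_affine]; positivity

end H5

end ThreeApex

end FK

end Summit.CriticalPhenomena.PercolationContinuityZ3.Theorems
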